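import Literature.NumberTheory.Automorphic.UnitaryTwoTreeActionTorusLift          -- ★ B-p08 (g28): generic torus lifts, `exists_comm_rhoVertexAct_mul_eq`, `rhoVertexAct_inv_pow_root_eq`
import Literature.NumberTheory.Automorphic.UnitaryTwoRamifiedTreeTorusStep         -- ★ B-p08 (g28) p843905: `exists_toPlace_eq_mul_galAdicCompletionMap_of_ramified` (+ ★ p843858/p843868 place action)
import HarnessLib

/-!
# The SHELL DECOMPOSITION of the vertices of the tree of `SL₂(L⁺_v)` under `U(Φ₂)(L_w)` at a ramified place — the `hshell` ∕ `r_m` pins of the orbital-integral unfolding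
# ★ `integral_conj_eq_smul_sum_shells_onePlace` (B-p14 (g33), road «W′» (Ψ1)) (Labesse–Langlands 1979 §2 p. 8)

Topic `NumberTheory/Automorphic`; namespace `Literature.NumberTheory.Automorphic.UnitaryGroup`.  THEOREMS ONLY (no definition, no instance, no notation, no named fact, no
`sorry`); kernel lane.  Cell `pub/hodgecm-mathlib` (D-0151), crux H413 = `stmt-HodgeConjecture-24833`; road «W′» = «R1LL-WILD» (architect A-p16 (g28), RULING A-37 (Ψ1):
B-p14 (g33) first, B-p08 (g28) second — «I will call you for the ρ-side pins `r_m` ∕ `hshell` by name», 11:41:41Z).  This file is those two pins AT THE PLACE, keyed on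
`u : ↥U_w`, `U_w := unitaryGroupOfForm σ_w (placeForm Φ₂ w.1)` and `rhoVertexActPlace` (★ p843858), over the generic ★ `UnitaryTwoTreeActionTorusLift`.
HONEST LABEL: HC_CM is proved only modulo the cell's 2 remaining named inputs (hLiu418, h413) until rung 0 closes; nothing printed is asserted here.

* `rhoVertexActPlace_inv_pow_root_eq` — **`r_m`**: for `ũ_η ∈ U_w` with `↑ũ_η = diag(η, (σ_w η)⁻¹)` (`η` a uniformiser of `L_w`), `ρ_w(ũ_η⁻¹ ^ m) · x₀ = diag(1, ϖ_F^m) · x₀`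
  (`x₀ = 𝒪_v²`) — the unitary shell representatives realise LL's `diag(1, ϖ^m)·v₀`.
* `exists_comm_rhoVertexActPlace_mul_eq` — **`hshell`**: given the GL₂(L⁺_v)-level shell decomposition of A-p17 (g23) (★ `exists_torus_glVertexAct_shellRep_eq`: every vertex is
  `(t · r (d x)) · x₀`, `t` in LL's elliptic torus `(c′, e′v₀; e′, c′ + e′u₀)` commuting with the descent `γ` of `u`) for an abstract quadratic datum `(τ_E; u₀, v₀)` of `L_w ∕ L⁺_v`
  (`τ_E² = ι(u₀)τ_E + ι(v₀)`, `σ_w τ_E = ι(u₀) − τ_E`; Eisenstein `τ_E = ϖ_E` at a ramified place, A-37 FLAG 1), and unitary `r̃ : ℕ → U_w` over `r` (`ρ_w(r̃ m)·x₀ = r m · x₀`):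
  `∀ x, ∃ t̃ : ↥U_w, t̃ u = u t̃ ∧ ρ_w(t̃ · r̃ (d x)) · x₀ = x`.

## References
* [LabesseLanglands1979] J.-P. Labesse, R. P. Langlands, *L-indistinguishability for SL(2)*, Canad. J. Math. 31 (1979), §2 p. 8.
* [Rogawski1990] J. D. Rogawski, *Automorphic Representations of Unitary Groups in Three Variables* (1990), §4.9 p. 54.
* [Serre1980Trees] J.-P. Serre, *Trees* (1980), Ch. II §1.3.
-/

set_option autoImplicit false

noncomputable section

open NumberField IsDedekindDomain
open scoped Matrix ValuativeRel MatrixGroups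
open Matrix ValuativeRel

namespace Literature.NumberTheory.Automorphic.UnitaryGroup

open Literature.NumberTheory.Automorphic Literature.NumberTheory.Automorphic.HermitianLatticeTree

section Place

variable (L : Type) [Field L] [NumberField L] [IsCMField L] (v : HeightOneSpectrum (𝓞 ↥(maximalRealSubfield L)))
  (w : PlacesOver L v) (hw : IsCMField.complexConj L • w.1 = w.1)
  {α : w.1.adicCompletion L} (hα : galAdicCompletionMap (L := L) (IsCMField.complexConj L) hw α = -α) (hα0 : α ≠ 0)
  {ϖF : v.adicCompletion ↥(maximalRealSubfield L)} (hϖF : Valued.v ϖF = WithZero.exp (-1 : ℤ))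

/-- `Subgroup.inclusion` along `U_w = U(σ_w, (0 1; 1 0))` and back is the identity. [cite: Serre1980Trees, Ch. II §1.3] -/
theorem inclusion_inclusion_eq (u : ↥(unitaryGroupOfForm (galAdicCompletionMap (L := L) (IsCMField.complexConj L) hw)
      (placeForm (Matrix.of fun i j : Fin 2 => if i.val + j.val + 1 = 2 then (1 : L) else 0) w.1))) :
    Subgroup.inclusion (unitaryGroupOfForm_placeForm_antidiagTwo_eq L v w (galAdicCompletionMap (L := L) (IsCMField.complexConj L) hw)).ge
      (Subgroup.inclusion (unitaryGroupOfForm_placeForm_antidiagTwo_eq L v w (galAdicCompletionMap (L := L) (IsCMField.complexConj L) hw)).le u) = u :=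
  Subtype.ext (by rw [Subgroup.coe_inclusion, Subgroup.coe_inclusion])

/-- … and in the other order. [cite: Serre1980Trees, Ch. II §1.3] -/
theorem inclusion_inclusion_eq' (u' : ↥(unitaryGroupOfForm (galAdicCompletionMap (L := L) (IsCMField.complexConj L) hw) !![(0 : w.1.adicCompletion L), 1; 1, 0])) :
    Subgroup.inclusion (unitaryGroupOfForm_placeForm_antidiagTwo_eq L v w (galAdicCompletionMap (L := L) (IsCMField.complexConj L) hw)).le
      (Subgroup.inclusion (unitaryGroupOfForm_placeForm_antidiagTwo_eq L v w (galAdicCompletionMap (L := L) (IsCMField.complexConj L) hw)).ge u') = u' :=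
  Subtype.ext (by rw [Subgroup.coe_inclusion, Subgroup.coe_inclusion])

variable (he : v.asIdeal.ramificationIdx' w.1.asIdeal ≠ 1)

include he in
/-- **THE UNITARY SHELL REPRESENTATIVES (`r_m`)**: for a uniformiser `η` of `L_w` and `ũ_η ∈ U_w` with `↑ũ_η = diag(η, (σ_w η)⁻¹)`,
`ρ_w(ũ_η⁻¹ ^ m) · x₀ = diag(1, ϖ_F^m) · x₀` (`x₀ = latt 1`). [cite: LabesseLanglands1979, §2 p. 8] [cite: Serre1980Trees, Ch. II §1.3] -/
theorem rhoVertexActPlace_inv_pow_root_eq [IsDiscreteValuationRing 𝒪[v.adicCompletion ↥(maximalRealSubfield L)]]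
    (η : (w.1.adicCompletion L)ˣ) (hη : Valued.v (η : w.1.adicCompletion L) = WithZero.exp (-1 : ℤ))
    {uη : ↥(unitaryGroupOfForm (galAdicCompletionMap (L := L) (IsCMField.complexConj L) hw)
      (placeForm (Matrix.of fun i j : Fin 2 => if i.val + j.val + 1 = 2 then (1 : L) else 0) w.1))}
    (huη : ((uη : GL (Fin 2) (w.1.adicCompletion L)) : Matrix (Fin 2) (Fin 2) (w.1.adicCompletion L)) =
      Matrix.diagonal ![(η : w.1.adicCompletion L), (galAdicCompletionMap (L := L) (IsCMField.complexConj L) hw (η : w.1.adicCompletion L))⁻¹])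
    {r : GL (Fin 2) (v.adicCompletion ↥(maximalRealSubfield L))} {m : ℕ}
    (hr : (r : Matrix (Fin 2) (Fin 2) (v.adicCompletion ↥(maximalRealSubfield L))) = Matrix.diagonal ![1, ϖF ^ m])
    (x₀ : {M : Submodule 𝒪[v.adicCompletion ↥(maximalRealSubfield L)] (Fin 2 → v.adicCompletion ↥(maximalRealSubfield L)) //
      IsSpecialLattice (RingHom.id _) ϖF !![(0 : v.adicCompletion ↥(maximalRealSubfield L)), 1; -1, 0] M})
    (hx₀ : x₀.1 = latt (1 : Matrix (Fin 2) (Fin 2) (v.adicCompletion ↥(maximalRealSubfield L)))) :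
    rhoVertexActPlace L v w hw hα hα0 hϖF (uη⁻¹ ^ m) x₀ = glVertexAct (isUniformizingElement_of_v_eq hϖF) r x₀ := by
  obtain ⟨c, hc, hcv⟩ := exists_toPlace_eq_mul_galAdicCompletionMap_of_ramified L v w hw hϖF he η hη
  rw [rhoVertexActPlace_eq_rhoVertexAct, map_pow, map_inv]
  exact rhoVertexAct_inv_pow_root_eq (toPlace v w) (galAdicCompletionMap (L := L) (IsCMField.complexConj L) hw) (isUniformizingElement_of_v_eq hϖF)
    (descent_of_mem_unitaryGroupOfForm_antidiag L v w hw hα hα0) hα0 (by rw [Subgroup.coe_inclusion]; exact huη) hc hcv hr x₀ hx₀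

/-- **THE SHELL DECOMPOSITION ON `U_w` (`hshell`)**: with an abstract quadratic datum `(τ_E; u₀, v₀)` of `L_w ∕ L⁺_v`, `u ∈ U_w` of descent `s · ι(γ)`, unitary `r̃` over `r`
(`ρ_w(r̃ m)·x₀ = (r m)·x₀`), and the GL₂(L⁺_v)-level decomposition `hGL` (A-p17 (g23) ★ `exists_torus_glVertexAct_shellRep_eq`): every vertex `x` is `ρ_w(t̃ · r̃ (d x)) · x₀` with
`t̃ ∈ U_w` commuting with `u`. [cite: LabesseLanglands1979, §2 p. 8] [cite: Rogawski1990, §4.9 p. 54] -/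
theorem exists_comm_rhoVertexActPlace_mul_eq [IsDiscreteValuationRing 𝒪[v.adicCompletion ↥(maximalRealSubfield L)]]
    {u₀ v₀ : v.adicCompletion ↥(maximalRealSubfield L)} {τE : w.1.adicCompletion L}
    (hτ : τE * τE = toPlace v w u₀ * τE + toPlace v w v₀) (hστ : galAdicCompletionMap (L := L) (IsCMField.complexConj L) hw τE = toPlace v w u₀ - τE)
    {u : ↥(unitaryGroupOfForm (galAdicCompletionMap (L := L) (IsCMField.complexConj L) hw)
      (placeForm (Matrix.of fun i j : Fin 2 => if i.val + j.val + 1 = 2 then (1 : L) else 0) w.1))}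
    {s : w.1.adicCompletion L} {γ : GL (Fin 2) (v.adicCompletion ↥(maximalRealSubfield L))}
    (hsu : Matrix.diagonal ![1, α] * ((u : GL (Fin 2) (w.1.adicCompletion L)) : Matrix (Fin 2) (Fin 2) (w.1.adicCompletion L)) * Matrix.diagonal ![1, α⁻¹] =
      s • (γ : Matrix (Fin 2) (Fin 2) (v.adicCompletion ↥(maximalRealSubfield L))).map (toPlace v w))
    (x₀ : {M : Submodule 𝒪[v.adicCompletion ↥(maximalRealSubfield L)] (Fin 2 → v.adicCompletion ↥(maximalRealSubfield L)) //
      IsSpecialLattice (RingHom.id _) ϖF !![(0 : v.adicCompletion ↥(maximalRealSubfield L)), 1; -1, 0] M})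
    {d : {M : Submodule 𝒪[v.adicCompletion ↥(maximalRealSubfield L)] (Fin 2 → v.adicCompletion ↥(maximalRealSubfield L)) //
      IsSpecialLattice (RingHom.id _) ϖF !![(0 : v.adicCompletion ↥(maximalRealSubfield L)), 1; -1, 0] M} → ℕ}
    {r : ℕ → GL (Fin 2) (v.adicCompletion ↥(maximalRealSubfield L))}
    {rU : ℕ → ↥(unitaryGroupOfForm (galAdicCompletionMap (L := L) (IsCMField.complexConj L) hw)
      (placeForm (Matrix.of fun i j : Fin 2 => if i.val + j.val + 1 = 2 then (1 : L) else 0) w.1))}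
    (hrU : ∀ m, rhoVertexActPlace L v w hw hα hα0 hϖF (rU m) x₀ = glVertexAct (isUniformizingElement_of_v_eq hϖF) (r m) x₀)
    (hGL : ∀ x : {M : Submodule 𝒪[v.adicCompletion ↥(maximalRealSubfield L)] (Fin 2 → v.adicCompletion ↥(maximalRealSubfield L)) //
        IsSpecialLattice (RingHom.id _) ϖF !![(0 : v.adicCompletion ↥(maximalRealSubfield L)), 1; -1, 0] M},
      ∃ (t : GL (Fin 2) (v.adicCompletion ↥(maximalRealSubfield L))) (c' e' : v.adicCompletion ↥(maximalRealSubfield L)),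
        (t : Matrix (Fin 2) (Fin 2) (v.adicCompletion ↥(maximalRealSubfield L))) = !![c', e' * v₀; e', c' + e' * u₀] ∧ t * γ = γ * t ∧
        glVertexAct (isUniformizingElement_of_v_eq hϖF) (t * r (d x)) x₀ = x)
    (x : {M : Submodule 𝒪[v.adicCompletion ↥(maximalRealSubfield L)] (Fin 2 → v.adicCompletion ↥(maximalRealSubfield L)) //
      IsSpecialLattice (RingHom.id _) ϖF !![(0 : v.adicCompletion ↥(maximalRealSubfield L)), 1; -1, 0] M}) :
    ∃ tU : ↥(unitaryGroupOfForm (galAdicCompletionMap (L := L) (IsCMField.complexConj L) hw)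
      (placeForm (Matrix.of fun i j : Fin 2 => if i.val + j.val + 1 = 2 then (1 : L) else 0) w.1)),
      tU * u = u * tU ∧ rhoVertexActPlace L v w hw hα hα0 hϖF (tU * rU (d x)) x₀ = x := by
  have hσι : ∀ y, galAdicCompletionMap (L := L) (IsCMField.complexConj L) hw (toPlace v w y) = toPlace v w y :=
    fun y => galAdicCompletionMap_toPlace (IsCMField.complexConj L) w w hw y
  -- apply the generic decomposition to the included elements
  have hrU' : ∀ m, rhoVertexAct (toPlace v w) (galAdicCompletionMap (L := L) (IsCMField.complexConj L) hw) (isUniformizingElement_of_v_eq hϖF)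
      (descent_of_mem_unitaryGroupOfForm_antidiag L v w hw hα hα0)
      (Subgroup.inclusion (unitaryGroupOfForm_placeForm_antidiagTwo_eq L v w _).le (rU m)) x₀ = glVertexAct (isUniformizingElement_of_v_eq hϖF) (r m) x₀ := by
    intro m; rw [← rhoVertexActPlace_eq_rhoVertexAct]; exact hrU m
  obtain ⟨tU', hcomm', hx'⟩ := exists_comm_rhoVertexAct_mul_eq (toPlace v w) (galAdicCompletionMap (L := L) (IsCMField.complexConj L) hw)
    (isUniformizingElement_of_v_eq hϖF) (descent_of_mem_unitaryGroupOfForm_antidiag L v w hw hα hα0) hσι hα hα0 hτ hστ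
    (u := Subgroup.inclusion (unitaryGroupOfForm_placeForm_antidiagTwo_eq L v w _).le u) (by rw [Subgroup.coe_inclusion]; exact hsu) x₀ hrU' hGL x
  refine ⟨Subgroup.inclusion (unitaryGroupOfForm_placeForm_antidiagTwo_eq L v w _).ge tU', ?_, ?_⟩
  · -- commutation transports along the inclusions
    have h := congrArg (Subgroup.inclusion (unitaryGroupOfForm_placeForm_antidiagTwo_eq L v w (galAdicCompletionMap (L := L) (IsCMField.complexConj L) hw)).ge) hcomm'
    rwa [map_mul, map_mul, inclusion_inclusion_eq] at h
  · rw [rhoVertexActPlace_eq_rhoVertexAct, map_mul, inclusion_inclusion_eq']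
    exact hx'

end Place

end Literature.NumberTheory.Automorphic.UnitaryGroup

end

/-! ## ED. 2 (append-only): the torus element `ũ_η = diag(η, (σ_w η)⁻¹)` EXISTS in `U_w` (for the END assembler's `rU m := ũ_η⁻¹ ^ m` and A-p06's `hstep`) -/

noncomputable section

open NumberField IsDedekindDomain
open scoped Matrix ValuativeRel MatrixGroups
open Matrix ValuativeRel

namespace Literature.NumberTheory.Automorphic.UnitaryGroup

open Literature.NumberTheory.Automorphic

section TorusElement

/-- **`diag(x, (σ x)⁻¹) ∈ U(σ, (0 1; 1 0))`** for `x ≠ 0` when `σ(σ x) = x` (the split torus of `U(1,1)`). [cite: Rogawski1990, §3.6 p. 31] -/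
theorem exists_mem_unitaryGroupOfForm_antidiag_coe_eq_diagonal {K : Type*} [Field K] (σ : K →+* K) {x : K} (hx : x ≠ 0) (hσσ : σ (σ x) = x) :
    ∃ u : ↥(unitaryGroupOfForm σ !![(0 : K), 1; 1, 0]), ((u : GL (Fin 2) K) : Matrix (Fin 2) (Fin 2) K) = Matrix.diagonal ![x, (σ x)⁻¹] := by
  have hσx : σ x ≠ 0 := by rw [map_ne_zero]; exact hx
  have hdet : (Matrix.diagonal ![x, (σ x)⁻¹]).det ≠ 0 := by
    rw [det_diagonal, Fin.prod_univ_two]; simp [hx, hσx]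
  refine ⟨⟨Matrix.GeneralLinearGroup.mk'' _ (isUnit_iff_ne_zero.2 hdet), ?_⟩, rfl⟩
  rw [mem_unitaryGroupOfForm_iff]
  show ((Matrix.diagonal ![x, (σ x)⁻¹]).map σ)ᵀ * !![(0 : K), 1; 1, 0] * Matrix.diagonal ![x, (σ x)⁻¹] = !![(0 : K), 1; 1, 0]
  rw [Matrix.diagonal_map (map_zero σ), Matrix.diagonal_transpose]
  ext i j
  fin_cases i <;> fin_cases j <;> simp [Matrix.mul_apply, Matrix.diagonal, hσσ, hx, hσx]

variable (L : Type) [Field L] [NumberField L] [IsCMField L] (v : HeightOneSpectrum (𝓞 ↥(maximalRealSubfield L)))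
  (w : PlacesOver L v) (hw : IsCMField.complexConj L • w.1 = w.1)

include hw in
/-- **THE TORUS ELEMENT `ũ_η ∈ U_w`**: for every `η ∈ L_w^×` there is `ũ_η ∈ U_w = U(σ_w, (Φ₂)_w)` with `↑ũ_η = diag(η, (σ_w η)⁻¹)`. [cite: Rogawski1990, §3.6 p. 31] -/
theorem exists_mem_coe_eq_diagonal_inv (η : (w.1.adicCompletion L)ˣ) :
    ∃ uη : ↥(unitaryGroupOfForm (galAdicCompletionMap (L := L) (IsCMField.complexConj L) hw)
      (placeForm (Matrix.of fun i j : Fin 2 => if i.val + j.val + 1 = 2 then (1 : L) else 0) w.1)),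
      ((uη : GL (Fin 2) (w.1.adicCompletion L)) : Matrix (Fin 2) (Fin 2) (w.1.adicCompletion L)) =
        Matrix.diagonal ![(η : w.1.adicCompletion L), (galAdicCompletionMap (L := L) (IsCMField.complexConj L) hw (η : w.1.adicCompletion L))⁻¹] := by
  obtain ⟨u, hu⟩ := exists_mem_unitaryGroupOfForm_antidiag_coe_eq_diagonal (galAdicCompletionMap (L := L) (IsCMField.complexConj L) hw) η.ne_zero
    (galAdicCompletionMap_galAdicCompletionMap_of_smul_eq (IsCMField.complexConj L) w (IsCMField.complexConj_ne_one L) hw _)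
  exact ⟨Subgroup.inclusion (unitaryGroupOfForm_placeForm_antidiagTwo_eq L v w _).ge u, by rw [Subgroup.coe_inclusion]; exact hu⟩

end TorusElement

end Literature.NumberTheory.Automorphic.UnitaryGroup

end
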